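import Summits.ValiantsHypothesis.ValiantsHypothesis.Theorems.GrenetZeonDualUnipotentThreeHalvesWordDefs

/-!
# `GrenetZeon.DualUnipotentThreeHalves` (stmt-ValiantsHypothesis-24318), R2 `HeavyTopLaw` — DEFINITIONS of the
# `krylov-seed` certificate vocabulary (val-idea-26 g0's card `Cruxes/DualUnipotentThreeHalves/Ideas/krylov-seed.md`, crit-7 KEEP)

Definitions only (no claims), split VERBATIM out of val-idea-26 g0's sorry-free `pub/ideators/val-idea-26/Sketch.lean`
(2026-08-28 16:55Z) so that the proofs (`…HeavyTopKrylovSeed.lean`) and a future line file can import them instead of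
re-declaring: `WeightThin` (one constant weight flag + one direction space certify the pencil — the hypothesis shape of ✓
`HeavyTopInvariantFlag.flagCheap_of_weight_levels`), its uniform law `UniformWeightLaw` (a strengthening C⁺ of R2 proposed by
the card — NOT asserted), the orbit span `W • F`, the Krylov flag of a seed, the orbit dimension and `σ(W) = minOrbit`.
Honest framing: vocabulary; nothing here proves or refutes `HeavyTopLaw`, 24318, S3b or 8062; `VP ≠ VNP` is not moved.
[val-idea-26 g0 (definitions); typed for the tree by val-port-3 g2]
-/

noncomputable section

-- single-conjunct layout: Sub = Summit, duplicated namespace component intended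
set_option linter.dupNamespace false

namespace Summit.ValiantsHypothesis.ValiantsHypothesis.Theorems.GrenetZeon.KrylovSeed

open MvPolynomial Matrix
open Summit.ValiantsHypothesis.ValiantsHypothesis.Cruxes.TwoDimCoefficients.DimTwoCases (AffMat IsAffine)
open Summit.ValiantsHypothesis.ValiantsHypothesis.Theorems.GrenetZeon.RadicalSplit

variable {m : ℕ}

/-- A pencil is **weight-thin** if ONE constant weight flag (change of basis `P`, levels `lvl < p`, drop `r`,
climb `c ≥ 1`) and ONE direction space `K` certify it: the whole pencil lowers levels by at most `r`, the tops
`N_lin(v)`, `v ∈ K`, raise levels by at least `c`, and `(⌊(p-1+r(n-1))/(c+r)⌋ + 1)·n < dim K`.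
`r = 0, c = 1` = invariant flags (Theorem G); `p = 3, r = c = 1` = the Hessenberg «one-level-return» flag. [val-idea-26] -/
def WeightThin (n m : ℕ) (N : AffMat n m) : Prop :=
  ∃ (P : (Matrix (Fin m) (Fin m) ℂ)ˣ) (lvl : Fin m → ℕ) (p r c : ℕ) (K : Submodule ℂ (Fin n × Fin n → ℂ)),
    1 ≤ c ∧ (∀ i, lvl i < p) ∧
    (∀ i j : Fin m, lvl i + r < lvl j →
      ((P : Matrix (Fin m) (Fin m) ℂ).map C * N * (↑P⁻¹ : Matrix (Fin m) (Fin m) ℂ).map C :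
        Matrix (Fin m) (Fin m) (MvPolynomial (Fin n × Fin n) ℂ)) i j = 0) ∧
    (∀ v ∈ K, ∀ i j : Fin m, lvl i < lvl j + c →
      ((P : Matrix (Fin m) (Fin m) ℂ) * linPart N v * (↑P⁻¹ : Matrix (Fin m) (Fin m) ℂ)) i j = 0) ∧
    ((p - 1 + r * (n - 1)) / (c + r) + 1) * n < Module.finrank ℂ K

/-- **`UniformWeightLaw`** — the card's strengthening C⁺ of R2: in the regime `C₀·m² < n³`, every affine nilpotent
heavy-top pencil is weight-thin.  A CANDIDATE law (not asserted; refuted at the C₀ = 1 format (4,7) by val-idea-26's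
`not_weightThin_NSeven` over ✓ p648631). [val-idea-26] -/
def UniformWeightLaw : Prop :=
  ∃ C₀ n₀ : ℕ, ∀ n ≥ n₀, ∀ m : ℕ, C₀ * m ^ 2 < n ^ 3 → ∀ N : AffMat n m, IsAffine N → N ^ m = 0 →
    (∀ K : Submodule ℂ (Fin n × Fin n → ℂ), RadOrth n m N K →
      Module.finrank ℂ K ≤ 16 * m * Nat.sqrt n + 16 * n) →
    WeightThin n m N

/-- The span of the orbits `W • F = span{A v : A ∈ W, v ∈ F}`. [val-idea-26] -/
def orbitSpan (W : Submodule ℂ (Matrix (Fin m) (Fin m) ℂ)) (F : Submodule ℂ (Fin m → ℂ)) :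
    Submodule ℂ (Fin m → ℂ) :=
  Submodule.span ℂ {y | ∃ A ∈ W, ∃ v ∈ F, y = A *ᵥ v}

/-- The Krylov flag of a seed `S`: `F₀ = 0`, `F_{t+1} = S + F_t + W • F_t`. [val-idea-26] -/
def krylov (W : Submodule ℂ (Matrix (Fin m) (Fin m) ℂ)) (S : Submodule ℂ (Fin m → ℂ)) :
    ℕ → Submodule ℂ (Fin m → ℂ)
  | 0 => ⊥
  | t + 1 => (S ⊔ krylov W S t) ⊔ orbitSpan W (krylov W S t)

/-- The **orbit dimension** of a vector, `dim (W • x)` (the rank of `x̂ : A ↦ A x` in de Seguins Pazzis' dual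
bounded-rank space). [val-idea-26] -/
def orbitDim (W : Submodule ℂ (Matrix (Fin m) (Fin m) ℂ)) (x : Fin m → ℂ) : ℕ :=
  Module.finrank ℂ (orbitSpan W (Submodule.span ℂ {x}))

/-- `σ(W) = min_{x ≠ 0} dim (W • x)` (`0` for `m = 0` by the junk value of `sInf ∅`). [val-idea-26] -/
def minOrbit (W : Submodule ℂ (Matrix (Fin m) (Fin m) ℂ)) : ℕ :=
  sInf {t | ∃ x : Fin m → ℂ, x ≠ 0 ∧ orbitDim W x = t}

end Summit.ValiantsHypothesis.ValiantsHypothesis.Theorems.GrenetZeon.KrylovSeed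

end
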